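import Summits.QuantumAdvantage.QuantumAdvantage.Theorems.SosSandwichPseudoBoundedDualCone
import Summits.QuantumAdvantage.QuantumAdvantage.Theorems.SosSandwichPseudoBoundedDualForward

/-!
# Route `SosSandwich`, support `PseudoBoundedDual` (stmt-QuantumAdvantage-15244) — conic duality on the finite cube

`p` is pseudo-bounded of order `T` iff every linear functional `Ẽ` on real functions of the cube with `Ẽ[1] = 1` and
`Ẽ[q²] ≥ 0` for all `q` of total degree `≤ T` satisfies `0 ≤ Ẽ[p] ≤ 1`. Forward: part `…DualForward`. Backward: the SOS
cone `C_T` is convex and CLOSED (part `…DualCone`), so a non-member is strictly separated by a continuous linear functional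
(`geometric_hahn_banach_point_closed`); normalising it — or, if it vanishes at `1`, mixing it with the true expectation —
produces a pseudo-expectation violating `0 ≤ Ẽ[p] ≤ 1`.
-/

set_option linter.dupNamespace false -- D-0017: single-problem summit ⇒ `QuantumAdvantage.QuantumAdvantage` by design

namespace Summit.QuantumAdvantage.QuantumAdvantage.Theorems.SosSandwich

open Finset MvPolynomial Literature.Computability.QuantumComplexity

variable {N : ℕ}

/-- Membership of a single square `(q)²`, `deg q ≤ T`, in the SOS cone. [folklore] -/
theorem sq_mem_sos {T : ℕ} (q : MvPolynomial (Fin N) ℝ) (hq : q.totalDegree ≤ T) :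
    (fun x => evalBool q x ^ 2) ∈ {f : (Fin N → Bool) → ℝ | ∃ (m : ℕ) (q : Fin m → MvPolynomial (Fin N) ℝ),
      (∀ j, (q j).totalDegree ≤ T) ∧ ∀ x, f x = ∑ j, evalBool (q j) x ^ 2} :=
  ⟨1, fun _ => q, fun _ => hq, fun x => by simp⟩

/-- The SOS cone is closed under addition. [folklore] -/
theorem add_mem_sos {T : ℕ} {f g : (Fin N → Bool) → ℝ}
    (hf : f ∈ {f : (Fin N → Bool) → ℝ | ∃ (m : ℕ) (q : Fin m → MvPolynomial (Fin N) ℝ),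
      (∀ j, (q j).totalDegree ≤ T) ∧ ∀ x, f x = ∑ j, evalBool (q j) x ^ 2})
    (hg : g ∈ {f : (Fin N → Bool) → ℝ | ∃ (m : ℕ) (q : Fin m → MvPolynomial (Fin N) ℝ),
      (∀ j, (q j).totalDegree ≤ T) ∧ ∀ x, f x = ∑ j, evalBool (q j) x ^ 2}) :
    f + g ∈ {f : (Fin N → Bool) → ℝ | ∃ (m : ℕ) (q : Fin m → MvPolynomial (Fin N) ℝ),
      (∀ j, (q j).totalDegree ≤ T) ∧ ∀ x, f x = ∑ j, evalBool (q j) x ^ 2} := by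
  obtain ⟨m₁, q₁, hd₁, hv₁⟩ := hf
  obtain ⟨m₂, q₂, hd₂, hv₂⟩ := hg
  refine ⟨m₁ + m₂, Fin.addCases q₁ q₂, fun j => ?_, fun x => ?_⟩
  · refine Fin.addCases (fun i => ?_) (fun i => ?_) j
    · simpa using hd₁ i
    · simpa using hd₂ i
  · rw [Fin.sum_univ_add]
    simp only [Fin.addCases_left, Fin.addCases_right, Pi.add_apply, hv₁ x, hv₂ x]

/-- The SOS cone is closed under nonnegative scaling. [folklore] -/
theorem smul_mem_sos {T : ℕ} {f : (Fin N → Bool) → ℝ} {t : ℝ} (ht : 0 ≤ t)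
    (hf : f ∈ {f : (Fin N → Bool) → ℝ | ∃ (m : ℕ) (q : Fin m → MvPolynomial (Fin N) ℝ),
      (∀ j, (q j).totalDegree ≤ T) ∧ ∀ x, f x = ∑ j, evalBool (q j) x ^ 2}) :
    t • f ∈ {f : (Fin N → Bool) → ℝ | ∃ (m : ℕ) (q : Fin m → MvPolynomial (Fin N) ℝ),
      (∀ j, (q j).totalDegree ≤ T) ∧ ∀ x, f x = ∑ j, evalBool (q j) x ^ 2} := by
  obtain ⟨m, q, hd, hv⟩ := hf
  refine ⟨m, fun j => C (Real.sqrt t) * q j, fun j => ?_, fun x => ?_⟩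
  · refine (totalDegree_mul _ _).trans ?_
    rw [totalDegree_C, zero_add]; exact hd j
  · rw [Pi.smul_apply, smul_eq_mul, hv x, Finset.mul_sum]
    refine Finset.sum_congr rfl fun j _ => ?_
    unfold evalBool
    rw [map_mul, eval_C, mul_pow, Real.sq_sqrt ht]

/-- **Separation for the SOS cone**: if every normalised pseudo-expectation of order `T` is nonnegative on `g`, then `g`
is a sum of squares of polynomials of total degree `≤ T` on the cube. [cite: KaniewskiLeeDewolf2015, Def. 7] -/
theorem mem_sos_of_forall_pseudoExp {T : ℕ} (g : (Fin N → Bool) → ℝ)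
    (hg : ∀ E : ((Fin N → Bool) → ℝ) →ₗ[ℝ] ℝ, E (fun _ => 1) = 1 →
      (∀ q : MvPolynomial (Fin N) ℝ, q.totalDegree ≤ T → 0 ≤ E (fun x => evalBool q x ^ 2)) → 0 ≤ E g) :
    g ∈ {f : (Fin N → Bool) → ℝ | ∃ (m : ℕ) (q : Fin m → MvPolynomial (Fin N) ℝ),
      (∀ j, (q j).totalDegree ≤ T) ∧ ∀ x, f x = ∑ j, evalBool (q j) x ^ 2} := by
  classical
  set C := {f : (Fin N → Bool) → ℝ | ∃ (m : ℕ) (q : Fin m → MvPolynomial (Fin N) ℝ),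
      (∀ j, (q j).totalDegree ≤ T) ∧ ∀ x, f x = ∑ j, evalBool (q j) x ^ 2} with hC
  by_contra hnot
  have hconv : Convex ℝ C := by
    intro f hf g' hg' a b ha hb _
    exact add_mem_sos (smul_mem_sos ha hf) (smul_mem_sos hb hg')
  have hzero : (0 : (Fin N → Bool) → ℝ) ∈ C := ⟨0, Fin.elim0, fun j => j.elim0, fun x => by simp⟩
  have hone : (fun _ : Fin N → Bool => (1 : ℝ)) ∈ C := by
    refine ⟨1, fun _ => 1, fun _ => by rw [totalDegree_one]; exact Nat.zero_le _, fun x => ?_⟩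
    simp [evalBool]
  obtain ⟨f, u, hfu, hub⟩ := geometric_hahn_banach_point_closed hconv (isClosed_sos T) hnot
  have hu0 : u < 0 := by simpa using hub 0 hzero
  -- f is nonnegative on the cone
  have hfC : ∀ b ∈ C, 0 ≤ f b := by
    intro b hb
    by_contra hneg
    push Not at hneg
    have ht : 0 ≤ u / f b := div_nonneg_of_nonpos hu0.le hneg.le
    have hmem : (u / f b) • b ∈ C := smul_mem_sos ht hb
    have h := hub _ hmem
    rw [map_smul, smul_eq_mul, div_mul_cancel₀ _ hneg.ne] at h
    exact lt_irrefl _ h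
  -- the linear functional and its values on squares and on 1
  have hEsq : ∀ q : MvPolynomial (Fin N) ℝ, q.totalDegree ≤ T →
      0 ≤ (f : ((Fin N → Bool) → ℝ) →ₗ[ℝ] ℝ) (fun x => evalBool q x ^ 2) :=
    fun q hq => hfC _ (sq_mem_sos q hq)
  have hf1 : 0 ≤ f (fun _ => 1) := hfC _ hone
  have hfg : f g < 0 := hfu.trans hu0
  -- the true expectation as a linear functional
  let avg : ((Fin N → Bool) → ℝ) →ₗ[ℝ] ℝ := ((2 : ℝ) ^ N)⁻¹ • ∑ x : Fin N → Bool, LinearMap.proj x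
  have havg : ∀ h : (Fin N → Bool) → ℝ, avg h = ((2 : ℝ) ^ N)⁻¹ * ∑ x, h x := by
    intro h
    simp only [avg, LinearMap.smul_apply, LinearMap.coe_sum, Finset.sum_apply, LinearMap.proj_apply,
      smul_eq_mul]
  have havg1 : avg (fun _ => 1) = 1 := by
    rw [havg]; simp
  have havgsq : ∀ q : MvPolynomial (Fin N) ℝ, 0 ≤ avg (fun x => evalBool q x ^ 2) := by
    intro q; rw [havg]; positivity
  rcases hf1.eq_or_lt with h0 | hpos
  · -- f 1 = 0: mix the separating functional with the true expectation
    have hfg0 : 0 < -f g := by linarith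
    have hne : f g ≠ 0 := hfg.ne
    let lam : ℝ := (|avg g| + 1) / (-f g)
    have hlam : 0 ≤ lam := div_nonneg (by positivity) hfg0.le
    let E : ((Fin N → Bool) → ℝ) →ₗ[ℝ] ℝ := avg + lam • (f : ((Fin N → Bool) → ℝ) →ₗ[ℝ] ℝ)
    have hE1 : E (fun _ => 1) = 1 := by
      simp only [E, LinearMap.add_apply, LinearMap.smul_apply, ContinuousLinearMap.coe_coe, smul_eq_mul,
        havg1, ← h0, mul_zero, add_zero]
    have hEsq' : ∀ q : MvPolynomial (Fin N) ℝ, q.totalDegree ≤ T → 0 ≤ E (fun x => evalBool q x ^ 2) := by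
      intro q hq
      simp only [E, LinearMap.add_apply, LinearMap.smul_apply, ContinuousLinearMap.coe_coe, smul_eq_mul]
      exact add_nonneg (havgsq q) (mul_nonneg hlam (hEsq q hq))
    have hEg := hg E hE1 hEsq'
    simp only [E, LinearMap.add_apply, LinearMap.smul_apply, ContinuousLinearMap.coe_coe, smul_eq_mul] at hEg
    have hlfg : lam * f g = -(|avg g| + 1) := by
      simp only [lam]
      field_simp
    rw [hlfg] at hEg
    have := le_abs_self (avg g)
    linarith
  · -- normalise
    let E : ((Fin N → Bool) → ℝ) →ₗ[ℝ] ℝ := (f (fun _ => 1))⁻¹ • (f : ((Fin N → Bool) → ℝ) →ₗ[ℝ] ℝ)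
    have hE1 : E (fun _ => 1) = 1 := by
      simp only [E, LinearMap.smul_apply, ContinuousLinearMap.coe_coe, smul_eq_mul]
      exact inv_mul_cancel₀ hpos.ne'
    have hEsq' : ∀ q : MvPolynomial (Fin N) ℝ, q.totalDegree ≤ T → 0 ≤ E (fun x => evalBool q x ^ 2) := by
      intro q hq
      simp only [E, LinearMap.smul_apply, ContinuousLinearMap.coe_coe, smul_eq_mul]
      exact mul_nonneg (inv_nonneg.mpr hpos.le) (hEsq q hq)
    have hEg := hg E hE1 hEsq'
    simp only [E, LinearMap.smul_apply, ContinuousLinearMap.coe_coe, smul_eq_mul] at hEg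
    have : f g < 0 := hfg
    have hinv : 0 < (f (fun _ => 1))⁻¹ := inv_pos.mpr hpos
    nlinarith


/-- **`SosSandwich.PseudoBoundedDual`** (stmt-QuantumAdvantage-15244): conic duality on the finite cube — `p` is pseudo-bounded
of order `T` iff every normalised linear functional that is nonnegative on squares of degree-`≤ T` polynomials (a degree-`2T`
pseudo-expectation) gives `0 ≤ Ẽ[p] ≤ 1`. Forward: apply `Ẽ` to the certificates; backward: closedness of the SOS cone +
Hahn–Banach separation, the zero-mass case removed by mixing with the true expectation.
[cite: KaniewskiLeeDewolf2015, Def. 7 and Thm. 12] -/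
theorem PseudoBoundedDual_proof :
    Summit.QuantumAdvantage.QuantumAdvantage.Theses.SosSandwich.PseudoBoundedDual := by
  unfold Summit.QuantumAdvantage.QuantumAdvantage.Theses.SosSandwich.PseudoBoundedDual
  intro N T p ev
  classical
  constructor
  · intro hK E hE1 hEsq
    exact pseudoBoundedDual_forward T p hK E hE1 hEsq
  · intro hE
    have h1 : evalBool p ∈ {f : (Fin N → Bool) → ℝ | ∃ (m : ℕ) (q : Fin m → MvPolynomial (Fin N) ℝ),
        (∀ j, (q j).totalDegree ≤ T) ∧ ∀ x, f x = ∑ j, evalBool (q j) x ^ 2} :=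
      mem_sos_of_forall_pseudoExp (T := T) _ (fun E hE1 hEsq => (hE E hE1 hEsq).1)
    have h2 : (fun x => 1 - evalBool p x) ∈ {f : (Fin N → Bool) → ℝ | ∃ (m : ℕ)
        (q : Fin m → MvPolynomial (Fin N) ℝ), (∀ j, (q j).totalDegree ≤ T) ∧
        ∀ x, f x = ∑ j, evalBool (q j) x ^ 2} := by
      refine mem_sos_of_forall_pseudoExp (T := T) _ (fun E hE1 hEsq => ?_)
      have h : E (evalBool p) ≤ 1 := (hE E hE1 hEsq).2
      have hsub : E (fun x => 1 - evalBool p x) = E (fun _ => (1 : ℝ)) - E (evalBool p) := by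
        rw [← map_sub]; rfl
      rw [hsub, hE1]
      linarith
    obtain ⟨m₁, q, hq, hqv⟩ := h1
    obtain ⟨m₂, r, hr, hrv⟩ := h2
    have hev0 : ∀ x : Fin N → Bool, evalBool (0 : MvPolynomial (Fin N) ℝ) x = 0 := fun x => map_zero _
    refine ⟨m₁ + m₂, Fin.addCases q (fun _ => 0), Fin.addCases (fun _ => 0) r, fun j => ?_, fun x => ⟨?_, ?_⟩⟩
    · refine Fin.addCases (fun i => ?_) (fun i => ?_) j
      · simp only [Fin.addCases_left, totalDegree_zero]
        exact ⟨hq i, Nat.zero_le _⟩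
      · simp only [Fin.addCases_right, totalDegree_zero]
        exact ⟨Nat.zero_le _, hr i⟩
    · have goal : evalBool p x = ∑ j : Fin (m₁ + m₂), evalBool (Fin.addCases q (fun _ => 0) j) x ^ 2 := by
        rw [Fin.sum_univ_add]
        simp only [Fin.addCases_left, Fin.addCases_right, hev0]
        rw [hqv x]; simp
      exact goal
    · have goal : 1 - evalBool p x = ∑ j : Fin (m₁ + m₂), evalBool (Fin.addCases (fun _ => 0) r j) x ^ 2 := by
        rw [Fin.sum_univ_add]
        simp only [Fin.addCases_left, Fin.addCases_right, hev0]
        have := hrv x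
        simp only at this
        rw [this]; simp
      exact goal

end Summit.QuantumAdvantage.QuantumAdvantage.Theorems.SosSandwich
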